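import Summits.QuantumFields.YangMills.Theorems.BalabanUVNodesN21GaussianTailRatio

/-!
# N21 (NE7c) · the UPPER tail ratio and κ-tuned windows: `M₃ ≤ 5` at every threshold `x ≥ 2` with `κ = x⁻²` (lens Card 51)

R134 seat pub-ymgap-dag-n21-d (g7), node N21 = NE7c (single-run shell-weight bound, NOT PRINTED in [Bałaban 1983–89],
NOT proved), lane of record at filing = dag-lead's WORDS map (K3 `SpineGivenEndpointR13Sep…`; `--kind proof --supports … --as helper`).
Part 5 of the Gaussian comparison-model series (`…GaussianMillsRatio`, `…GaussianSupDensityBound`, `…Hetero`, `…GaussianTailRatio`).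

THIS FILE = LENS ROW X of `ym-lens-BalabanUVNodes-nearmiss/LENS-nearmiss.md` v18.0 (first refusal dag-n21-d): the §T + §A
sections of the lens's `Sketch-nearmiss-g18.lean` (sha16 119679f778d442a5, farm rc 0 · 0 warnings at the lens desk) VERBATIM —
statements and proofs — re-homed in this namespace with this credit header; AUTHORSHIP OF THE MATHEMATICS: planner seat
`ym-lens-BalabanUVNodes-nearmiss` g18 (memo-only seat, cannot file); this seat only files.
QUALIFICATION OF PART 4 (`…N21GaussianTailRatio.tendsto_tailRatio_atTop`: «NO threshold-uniform constant `M₃`») — that is a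
statement at FIXED `κ`; on the END's live window (`T4ShellMeasureLevels.LiveWindow`: `N₁ + 1` ages) a finite `M₃` always exists
(§A `exists_M3_on_liveWindow`, any threshold profile, any `κ`), and with the window fraction TUNED as `κ = x⁻²` the upper tail
ratio `Φ̄((1−κ)x)∕Φ̄(x) ≤ e^{κ(2−κ)x²∕2}·(x² + 1)∕((1−κ)x²)` (§T `tail_ratio_upper`, the companion of part 4's lower bound) gives
`M₃ ≤ 5` at EVERY threshold `x ≥ 2` (`tail_ratio_le_five`, `measure_Ici_ratio_le_five`), at the price `κ⁻¹ = x²` in the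
(M1) constant — polylogarithmic in the coupling, inside ROW T's summable tolerance (lens Card 51).

HONEST FRAMING.  [textbook] probability in the comparison model; what the TRUE measure owes on this road is a conditional
large-side tail ratio (a LOWER bound on large-field probabilities) — NOT PRINTED; 0 def, 0 sorry; nothing of Bałaban's
asserted.  NE7c NOT PRINTED ∕ NOT proved; N21 NOT discharged; counts unmoved (typed 28∕28 · discharged 5∕27); count-neutral;
one finite 𝕋⁴ at fixed ε — nothing about ℝ⁴ ∕ OS ∕ mass gap ∕ Clay.
-/

set_option autoImplicit false

open MeasureTheory ProbabilityTheory Set Filter Topology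
open scoped ENNReal NNReal

namespace Summit.QuantumFields.YangMills.Theorems.N21GaussianTailRatioUpper

open Summit.QuantumFields.YangMills.Theorems.N21GaussianMillsRatio
open Summit.QuantumFields.YangMills.Theorems.N21GaussianTailRatio

/-! ## §T  Card 51 — the UPPER tail ratio and κ-tuned selection windows -/

section TailRatio

/-- **T1. UPPER BOUND ON THE GAUSSIAN TAIL RATIO** (companion of G4's `tail_ratio_lower`): for `κ < 1`, `z > 0`,
`Φ̄((1−κ)z) ≤ exp(κ(2−κ)z²∕2)·((z²+1)∕((1−κ)z²))·Φ̄(z)` — upper Mills at `(1−κ)z`, `φ((1−κ)z) = e^{κ(2−κ)z²∕2}φ(z)`,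
Gordon at `z` (all three BY NAME from parts 1∕4). [textbook] -/
theorem tail_ratio_upper {κ z : ℝ} (hκ1 : κ < 1) (hz : 0 < z) :
    1 - cdf (gaussianReal 0 1) ((1 - κ) * z)
      ≤ Real.exp (κ * (2 - κ) * z ^ 2 / 2) * ((z ^ 2 + 1) / ((1 - κ) * z ^ 2)) * (1 - cdf (gaussianReal 0 1) z) := by
  have h1κ : 0 < 1 - κ := by linarith
  have hw : 0 < (1 - κ) * z := mul_pos h1κ hz
  have hz0 : z ≠ 0 := hz.ne'
  have hk0 : 1 - κ ≠ 0 := h1κ.ne'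
  have hup := one_sub_cdf_std_le_div hw
  rw [gaussianPDFReal_ratio κ z] at hup
  have hg := gordon_mills hz
  have hφ : gaussianPDFReal 0 1 z ≤ (z ^ 2 + 1) * (1 - cdf (gaussianReal 0 1) z) / z := by
    have hcomm : gaussianPDFReal 0 1 z * z = z * gaussianPDFReal 0 1 z := mul_comm _ _
    rw [le_div_iff₀ hz, hcomm]
    exact hg
  have hE : 0 < Real.exp (κ * (2 - κ) * z ^ 2 / 2) := Real.exp_pos _
  calc 1 - cdf (gaussianReal 0 1) ((1 - κ) * z)
      ≤ Real.exp (κ * (2 - κ) * z ^ 2 / 2) * gaussianPDFReal 0 1 z / ((1 - κ) * z) := hup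
    _ ≤ Real.exp (κ * (2 - κ) * z ^ 2 / 2) * ((z ^ 2 + 1) * (1 - cdf (gaussianReal 0 1) z) / z) / ((1 - κ) * z) :=
        div_le_div_of_nonneg_right (mul_le_mul_of_nonneg_left hφ hE.le) hw.le
    _ = Real.exp (κ * (2 - κ) * z ^ 2 / 2) * ((z ^ 2 + 1) / ((1 - κ) * z ^ 2)) * (1 - cdf (gaussianReal 0 1) z) := by
        field_simp

/-- **T2. κ-TUNED WINDOW**: at window fraction `κ = z⁻²` (`z > 1`) the tail ratio is at most `e·(z²+1)∕(z²−1)` — bounded at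
EVERY threshold, against G4's divergence at fixed `κ`. [textbook] -/
theorem tail_ratio_le_of_kappa_eq_inv_sq {z : ℝ} (hz : 1 < z) :
    1 - cdf (gaussianReal 0 1) ((1 - (z ^ 2)⁻¹) * z)
      ≤ Real.exp 1 * ((z ^ 2 + 1) / (z ^ 2 - 1)) * (1 - cdf (gaussianReal 0 1) z) := by
  have hz0 : 0 < z := by linarith
  have hz2 : 1 < z ^ 2 := by nlinarith
  have hz2pos : 0 < z ^ 2 := by positivity
  have hz2ne : z ^ 2 ≠ 0 := hz2pos.ne'
  have hκ1 : (z ^ 2)⁻¹ < 1 := inv_lt_one_of_one_lt₀ hz2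
  have h := tail_ratio_upper hκ1 hz0
  have hinv : (z ^ 2)⁻¹ * z ^ 2 = 1 := inv_mul_cancel₀ hz2ne
  have hexp_le : (z ^ 2)⁻¹ * (2 - (z ^ 2)⁻¹) * z ^ 2 / 2 ≤ 1 := by
    have hrw : (z ^ 2)⁻¹ * (2 - (z ^ 2)⁻¹) * z ^ 2 / 2 = 1 - (z ^ 2)⁻¹ / 2 := by
      have : (z ^ 2)⁻¹ * (2 - (z ^ 2)⁻¹) * z ^ 2 = ((z ^ 2)⁻¹ * z ^ 2) * (2 - (z ^ 2)⁻¹) := by ring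
      rw [this, hinv]
      ring
    rw [hrw]
    have : 0 < (z ^ 2)⁻¹ := by positivity
    linarith
  have hden : (1 - (z ^ 2)⁻¹) * z ^ 2 = z ^ 2 - 1 := by
    rw [sub_mul, one_mul, hinv]
  have hΦ : 0 ≤ 1 - cdf (gaussianReal 0 1) z := (one_sub_cdf_std_pos z).le
  have hfrac : 0 ≤ (z ^ 2 + 1) / (z ^ 2 - 1) := div_nonneg (by positivity) (by linarith)
  rw [hden] at h
  refine h.trans ?_
  apply mul_le_mul_of_nonneg_right _ hΦ
  exact mul_le_mul_of_nonneg_right (Real.exp_le_exp.2 hexp_le) hfrac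

/-- **T3. `M₃ ≤ 5`** at `κ = z⁻²` for every `z ≥ 2` (`e < 2.7182818286`, `(z²+1)∕(z²−1) ≤ 5∕3`). [textbook] -/
theorem tail_ratio_le_five {z : ℝ} (hz : 2 ≤ z) :
    1 - cdf (gaussianReal 0 1) ((1 - (z ^ 2)⁻¹) * z) ≤ 5 * (1 - cdf (gaussianReal 0 1) z) := by
  have h := tail_ratio_le_of_kappa_eq_inv_sq (show (1 : ℝ) < z by linarith)
  have hΦ : 0 ≤ 1 - cdf (gaussianReal 0 1) z := (one_sub_cdf_std_pos z).le
  have hz2 : 4 ≤ z ^ 2 := by nlinarith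
  have hfrac : (z ^ 2 + 1) / (z ^ 2 - 1) ≤ 5 / 3 := by
    rw [div_le_iff₀ (by linarith : (0 : ℝ) < z ^ 2 - 1)]
    linarith
  have hfrac0 : 0 ≤ (z ^ 2 + 1) / (z ^ 2 - 1) := div_nonneg (by positivity) (by linarith)
  have he : Real.exp 1 ≤ 2.7182818286 := Real.exp_one_lt_d9.le
  have hprod : Real.exp 1 * ((z ^ 2 + 1) / (z ^ 2 - 1)) ≤ 5 :=
    calc Real.exp 1 * ((z ^ 2 + 1) / (z ^ 2 - 1)) ≤ 2.7182818286 * (5 / 3) := mul_le_mul he hfrac hfrac0 (by norm_num)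
      _ ≤ 5 := by norm_num
  exact h.trans (mul_le_mul_of_nonneg_right hprod hΦ)

/-- **T4.** The measure form (G4's `tendsto_measure_Ici_ratio_atTop` counterpart): for `θ ≥ 2`,
`N(0,1)([(1−θ⁻²)θ, ∞)) ≤ 5·N(0,1)([θ, ∞))` — the large-side shell `[(1−κ)θ, θ)` of the κ-TUNED window weighs at most four tails.
[textbook] -/
theorem measure_Ici_ratio_le_five {θ : ℝ} (hθ : 2 ≤ θ) :
    (gaussianReal 0 1).real (Ici ((1 - (θ ^ 2)⁻¹) * θ)) ≤ 5 * (gaussianReal 0 1).real (Ici θ) := by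
  haveI := nullSingletonClass_gaussianReal (μ := (0 : ℝ)) (v := (1 : ℝ≥0)) one_ne_zero
  have hIci : ∀ a : ℝ, (gaussianReal 0 1).real (Ici a) = 1 - cdf (gaussianReal 0 1) a := fun a => by
    rw [measureReal_congr (Ioi_ae_eq_Ici (μ := gaussianReal 0 1) (a := a)).symm, cdf_eq_real,
      ← probReal_compl_eq_one_sub measurableSet_Iic, compl_Iic]
  rw [hIci, hIci]
  exact tail_ratio_le_five hθ

/-- **T5. FIXED `κ`, BOUNDED THRESHOLD RANGE**: for `0 ≤ κ < 1` and `z ∈ [z₀, z₁]`, `z₀ > 0`, one constant serves the whole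
range: `Φ̄((1−κ)z) ≤ exp(κ(2−κ)z₁²∕2)·((z₀²+1)∕((1−κ)z₀²))·Φ̄(z)`. [textbook] -/
theorem tail_ratio_le_uniform {κ z₀ z₁ z : ℝ} (hκ0 : 0 ≤ κ) (hκ1 : κ < 1) (hz₀ : 0 < z₀) (hz : z ∈ Icc z₀ z₁) :
    1 - cdf (gaussianReal 0 1) ((1 - κ) * z)
      ≤ Real.exp (κ * (2 - κ) * z₁ ^ 2 / 2) * ((z₀ ^ 2 + 1) / ((1 - κ) * z₀ ^ 2)) * (1 - cdf (gaussianReal 0 1) z) := by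
  have hzpos : 0 < z := lt_of_lt_of_le hz₀ hz.1
  have h := tail_ratio_upper hκ1 hzpos
  have hΦ : 0 ≤ 1 - cdf (gaussianReal 0 1) z := (one_sub_cdf_std_pos z).le
  have h1κ : 0 < 1 - κ := by linarith
  have hexp : κ * (2 - κ) * z ^ 2 / 2 ≤ κ * (2 - κ) * z₁ ^ 2 / 2 := by
    have hk : 0 ≤ κ * (2 - κ) := mul_nonneg hκ0 (by linarith)
    have hzz : z ^ 2 ≤ z₁ ^ 2 := pow_le_pow_left₀ hzpos.le hz.2 2
    have := mul_le_mul_of_nonneg_left hzz hk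
    linarith
  have hzsq : 0 < z ^ 2 := by positivity
  have hz0sq : 0 < z₀ ^ 2 := by positivity
  have hfrac : (z ^ 2 + 1) / ((1 - κ) * z ^ 2) ≤ (z₀ ^ 2 + 1) / ((1 - κ) * z₀ ^ 2) := by
    rw [div_le_div_iff₀ (mul_pos h1κ hzsq) (mul_pos h1κ hz0sq)]
    have hzz : z₀ ^ 2 ≤ z ^ 2 := pow_le_pow_left₀ hz₀.le hz.1 2
    -- (z²+1)(1−κ)z₀² ≤ (z₀²+1)(1−κ)z²  ⟺  (1−κ)(z₀² − z²) ≤ 0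
    nlinarith [mul_nonneg h1κ.le (sub_nonneg.2 hzz)]
  have hfrac0 : 0 ≤ (z₀ ^ 2 + 1) / ((1 - κ) * z₀ ^ 2) := div_nonneg (by positivity) (mul_pos h1κ hz0sq).le
  refine h.trans ?_
  apply mul_le_mul_of_nonneg_right _ hΦ
  exact mul_le_mul (Real.exp_le_exp.2 hexp) hfrac (div_nonneg (by positivity) (mul_pos h1κ hzsq).le) (Real.exp_pos _).le

end TailRatio

/-! ## §A  the END quantifies over finitely many AGES (`T4ShellMeasureLevels.LiveWindow`: `K − N₁ ≤ j ≤ K`) -/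

section Ages

/-- **A1.** An age-indexed quantity `f (K − j)` is bounded on the live window `j ≤ K ≤ j + N₁` — a maximum over `N₁ + 1` ages.
[folklore] -/
theorem exists_bound_on_liveWindow (f : ℕ → ℝ) (N₁ : ℕ) :
    ∃ M : ℝ, ∀ K j : ℕ, j ≤ K → K ≤ j + N₁ → f (K - j) ≤ M := by
  refine ⟨(Finset.range (N₁ + 1)).sup' ⟨0, by simp⟩ f, fun K j hjK hKj => ?_⟩
  apply Finset.le_sup'
  rw [Finset.mem_range]
  omega

/-- **A2. THE END'S `M₃` IS A FINITE MAXIMUM.** For ANY age-indexed threshold profile `x : ℕ → ℝ` (print: `x_a = p₀(g_{K−a})`,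
[Bałaban CMP 119] p.244 and (1.4) p.246) and any window fraction `κ`, ONE constant `M₃` serves every live slot of every
comparison `K` — G4's `tendsto_tailRatio_atTop` quantifies over all thresholds, the END over `N₁ + 1` ages. [folklore] -/
theorem exists_M3_on_liveWindow (x : ℕ → ℝ) (κ : ℝ) (N₁ : ℕ) :
    ∃ M₃ : ℝ, ∀ K j : ℕ, j ≤ K → K ≤ j + N₁ →
      1 - cdf (gaussianReal 0 1) ((1 - κ) * x (K - j)) ≤ M₃ * (1 - cdf (gaussianReal 0 1) (x (K - j))) := by
  obtain ⟨M, hM⟩ := exists_bound_on_liveWindow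
    (fun a => (1 - cdf (gaussianReal 0 1) ((1 - κ) * x a)) / (1 - cdf (gaussianReal 0 1) (x a))) N₁
  refine ⟨M, fun K j hjK hKj => ?_⟩
  have hpos := one_sub_cdf_std_pos (x (K - j))
  have h := hM K j hjK hKj
  rwa [div_le_iff₀ hpos] at h

end Ages

end Summit.QuantumFields.YangMills.Theorems.N21GaussianTailRatioUpper
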